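import Summits.QuantumFields.QCD.Theses.HeatSlicedQuarks
import Summits.QuantumFields.QCD.Theorems.RobustYangMillsHandover.Negative.GapClauses
import Summits.QuantumFields.QCD.Theorems.RobustYangMillsHandover.Negative.ChiralityObstruction

/-!
# Strategy census `s12` (family `s`, INDEPENDENT) — kernel companion

Crux `stmt-QuantumFields-8892`, `HeatSlicedQuarks.RobustYangMillsHandover := ContinuumQCDExists → QCD`
(route `route-QuantumFields-HeatSlicedQuarks`, `closes … (h5 : RobustYangMillsHandover) : QCD :=
h5 (h4g h4a h4b h2 h3)`).

This file is the kernel-checked half of `STRATEGY-CENSUS-s12.md` (strategist seat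
`planner-cstrat-stmt-QuantumFields-8892-s12-0`, 2026-08-17; written BEFORE reading any earlier census of
the crux).  It is definition-light pure logic over the tree's declarations and the landed negative-lane
theorems (`Negative/GapClauses.lean`, `Negative/ChiralityObstruction.lean`); no `sorry`, no new axioms.
What it certifies, heading by heading of the census:

* §1 WEAKER INTERMEDIATE FROM THE SUMMIT — `slot_minimal`: any statement `W` that could replace the crux in
  its slot of `closes` (glue `X₀ → W → QCD`) already implies the crux; `qcd_iff_target_and_crux`: the
  summit is literally `target ∧ crux`.
* §2 THE X₀-FREE CORE — `ChiralLatticeGapAF Nf` (one asymptotically scaling, mass-scaling, CHIRALLY PINNED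
  regularisation, lattice-gapped at every positive mass tuple: a pure lattice statement at weak coupling)
  is forced by `QCDOf Nf` (`core_of_qcdOf`) and hence by crux ∧ target (`core_of_crux`), and it is never
  in the uniformly-gapped branch (`core_not_uniformly_gapped`).
* §3 THE OUT-OF-SLOT RECUT — moving the chiral pinning into the target (`ContinuumQCDExistsChiral`,
  `ChiralHandover`) gives a handover implied by the crux (`chiralHandover_of_crux`) that still demands the
  same core (`core_of_chiralHandover`); the summit is again `target' ∧ crux'` (`qcd_iff_chiral_split`).
* §4 DECOMPOSITION — the best two-piece cut this seat could type that is not the landed three-piece split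
  (`Split.RobustYangMillsHandover_of_subs`): `PinnedDataWithLatticeGap ∧ GapTransfer → crux`
  (`crux_of_pieces`, proved), and the certificate of NO LEVERAGE: modulo the transfer piece the lattice
  piece is EQUIVALENT to the crux (`pinnedData_of_crux`, `pinnedData_iff_crux_of_transfer`).
* §5 STRENGTHEN — the same-regularisation, chirally-pinned lattice-gap statement `SameRegPinnedLatticeGap`
  serves only the recut handover (`chiralHandover_of_sameReg`), never the crux without a pinning supplier.
-/

namespace Summit.QuantumFields.QCD.Cruxes.RobustYangMillsHandover.CensusS12

open Summit.QuantumFields.QCD.Theses.HeatSlicedQuarks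
open Summit.QuantumFields.QCD.Theorems.RobustYangMillsHandover.Negative
open Literature.MathematicalPhysics.QuantumFieldTheory

/-! ## §1 Weaker intermediate from the summit: the crux is slot-minimal -/

/-- **Slot-minimality.** Any `W` that could replace the crux in the last slot of `closes` — i.e. for
which the glue `X₀ → W → QCD` is provable — already implies the crux. So no STRICTLY weaker statement
can be handed to provers in that slot. [folklore] -/
theorem slot_minimal (W : Prop) (glue : ContinuumQCDExists → W → _root_.QCD) :
    W → RobustYangMillsHandover :=
  fun w x => glue x w

/-- The crux itself is admissible in the slot (so it is the weakest admissible `W`). [folklore] -/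
theorem slot_glue : ContinuumQCDExists → RobustYangMillsHandover → _root_.QCD :=
  fun x c => c x

/-- The route target is a consequence of the summit conjunct. [folklore] -/
theorem continuumQCDExists_of_qcd (h : _root_.QCD) : ContinuumQCDExists := by
  intro Nf hNf
  have hQ : QCDOf Nf := by
    rcases hNf with rfl | rfl
    exacts [h.1, h.2]
  obtain ⟨reg, hMS, -, hall⟩ := hQ
  refine ⟨reg, hMS, fun m hm => ?_⟩
  obtain ⟨z, shift, T, hA, hN, hG, hP, -⟩ := hall m hm
  exact ⟨z, shift, T, hA, hN, hG, hP⟩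

/-- **Summit = target ∧ crux** (so, jointly, the route's two open items are exactly the summit; the
crux alone is `target → summit`). [folklore] -/
theorem qcd_iff_target_and_crux : _root_.QCD ↔ ContinuumQCDExists ∧ RobustYangMillsHandover :=
  ⟨fun h => ⟨continuumQCDExists_of_qcd h, fun _ => h⟩, fun h => h.2 h.1⟩

/-! ## §2 The X₀-free lattice core every proof of the crux must produce -/

/-- Asymptotic scaling of `reg.scheme m z shift` reads only `reg.β`, `reg.a`. [folklore] -/
theorem hasAsymptoticScaling_scheme_irrel {Nf : ℕ} (reg : QCDRegularisation Nf)
    (m m' : Fin Nf → ℝ) (z shift z' shift' : QCDField Nf → ℕ → ℝ) :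
    (reg.scheme m z shift).HasAsymptoticScaling ↔ (reg.scheme m' z' shift').HasAsymptoticScaling :=
  Iff.rfl

/-- **The X₀-free core** `ChiralLatticeGapAF N_f`: ONE regularisation with two-loop asymptotic scaling
(`β_k → ∞` at the asymptotic-freedom rate — weak coupling is forced), leading-log mass scaling, CHIRALLY
PINNED (`IsChiralAtZero`: the lattice gap closes as `m → 0⁺`), and lattice-gapped uniformly in the volume
at EVERY positive renormalised mass tuple. A statement about lattice QCD with `N_f` Wilson flavours along
bare trajectories alone: no OS data, no continuum object. [folklore] -/
def ChiralLatticeGapAF (Nf : ℕ) : Prop :=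
  ∃ reg : QCDRegularisation Nf, reg.HasMassScaling ∧ (reg.scheme 0 0 0).HasAsymptoticScaling ∧
    reg.IsChiralAtZero ∧
      ∀ m : Fin Nf → ℝ, (∀ f, 0 < m f) → ∃ Δ > 0, (reg.scheme m 0 0).HasLatticeMassGap Δ

/-- `QCDOf N_f` forces the core (drop the continuum data, keep the scheme's asymptotic scaling from any
one positive tuple, move the lattice gap clause to species data `0`). [folklore] -/
theorem core_of_qcdOf {Nf : ℕ} (h : QCDOf Nf) : ChiralLatticeGapAF Nf := by
  obtain ⟨reg, hMS, hχ, hall⟩ := h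
  refine ⟨reg, hMS, ?_, hχ, fun m hm => ?_⟩
  · obtain ⟨z, shift, T, hA, -⟩ := hall (fun _ => 1) (fun _ => zero_lt_one)
    exact (hasAsymptoticScaling_scheme_irrel reg _ _ _ _ _ _).mp hA.1
  · obtain ⟨z, shift, T, -, -, -, -, Δ, hΔ, -, hL⟩ := hall m hm
    exact ⟨Δ, hΔ, (hasLatticeMassGap_scheme_indep reg m z shift 0 0 Δ).mp hL⟩

/-- **Crux ∧ target ⊢ the core for `N_f = 2` and `N_f = 3`.** Whatever line proves the crux, composed
with the route's engine it is a proof of the weak-coupling, chirally pinned lattice mass gap of two- and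
three-flavour Wilson lattice QCD at all positive quark masses. [folklore] -/
theorem core_of_crux (hC : RobustYangMillsHandover) (hX : ContinuumQCDExists) :
    ChiralLatticeGapAF 2 ∧ ChiralLatticeGapAF 3 :=
  ⟨core_of_qcdOf (hC hX).1, core_of_qcdOf (hC hX).2⟩

/-- The core is never in the uniformly-gapped branch of `isChiralAtZero_or_uniformLatticeGap`: its
regularisation has gaps `Δ(m) > 0` at every positive tuple but NO uniform rate — the light-quark
(chiral) regime is inside it. [folklore] -/
theorem core_not_uniformly_gapped {Nf : ℕ} (h : ChiralLatticeGapAF Nf) :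
    ∃ reg : QCDRegularisation Nf, reg.IsChiralAtZero ∧
      (∀ m : Fin Nf → ℝ, (∀ f, 0 < m f) → ∃ Δ > 0, (reg.scheme m 0 0).HasLatticeMassGap Δ) ∧
      ¬ ∃ ε > (0 : ℝ), ∀ m : Fin Nf → ℝ, (∀ f, 0 < m f) → (reg.scheme m 0 0).HasLatticeMassGap ε := by
  obtain ⟨reg, -, -, hχ, hgap⟩ := h
  refine ⟨reg, hχ, hgap, ?_⟩
  rintro ⟨ε, hε, hU⟩
  exact not_isChiralAtZero_of_uniformLatticeGap reg hε hU hχ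

/-! ## §3 The out-of-slot recut: chiral pinning moved into the target -/

/-- `X₀^χ`: the route target with the chiral pinning `reg.IsChiralAtZero` added (what the engine would
have to deliver if the pinning were recut into it). [folklore] -/
def ContinuumQCDExistsChiral : Prop :=
  ∀ Nf : ℕ, Nf = 2 ∨ Nf = 3 → ∃ reg : QCDRegularisation Nf, reg.HasMassScaling ∧ reg.IsChiralAtZero ∧
    ∀ m : Fin Nf → ℝ, (∀ f, 0 < m f) →
      ∃ (z shift : QCDField Nf → ℕ → ℝ) (T : OSData (QCDField Nf) 4),
        IsQCDAlong (reg.scheme m z shift) T ∧ T.IsNontrivial QCDField.glue ∧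
          T.IsNonGaussian QCDField.glue ∧ ∀ f g : Fin Nf, f ≠ g → T.IsNontrivial (QCDField.pseudoRe f g)

/-- `C^χ`: the recut handover. [folklore] -/
def ChiralHandover : Prop :=
  ContinuumQCDExistsChiral → _root_.QCD

/-- `X₀^χ → X₀`. [folklore] -/
theorem continuumQCDExists_of_chiral (h : ContinuumQCDExistsChiral) : ContinuumQCDExists := by
  intro Nf hNf
  obtain ⟨reg, hMS, -, hall⟩ := h Nf hNf
  exact ⟨reg, hMS, hall⟩

/-- The summit gives `X₀^χ`. [folklore] -/
theorem continuumQCDExistsChiral_of_qcd (h : _root_.QCD) : ContinuumQCDExistsChiral := by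
  intro Nf hNf
  have hQ : QCDOf Nf := by
    rcases hNf with rfl | rfl
    exacts [h.1, h.2]
  obtain ⟨reg, hMS, hχ, hall⟩ := hQ
  refine ⟨reg, hMS, hχ, fun m hm => ?_⟩
  obtain ⟨z, shift, T, hA, hN, hG, hP, -⟩ := hall m hm
  exact ⟨z, shift, T, hA, hN, hG, hP⟩

/-- **The recut handover is implied by the crux** (it is weaker or equal). [folklore] -/
theorem chiralHandover_of_crux (hC : RobustYangMillsHandover) : ChiralHandover :=
  fun hχ => hC (continuumQCDExists_of_chiral hχ)

/-- … and the summit is again `target' ∧ crux'`. [folklore] -/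
theorem qcd_iff_chiral_split : _root_.QCD ↔ ContinuumQCDExistsChiral ∧ ChiralHandover :=
  ⟨fun h => ⟨continuumQCDExistsChiral_of_qcd h, fun _ => h⟩, fun h => h.2 h.1⟩

/-- **But the recut demands the same X₀-free core**: the chiral pinning handed in does not touch the
weak-coupling lattice gap at every positive mass. [folklore] -/
theorem core_of_chiralHandover (hC : ChiralHandover) (hX : ContinuumQCDExistsChiral) :
    ChiralLatticeGapAF 2 ∧ ChiralLatticeGapAF 3 :=
  ⟨core_of_qcdOf (hC hX).1, core_of_qcdOf (hC hX).2⟩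

/-! ## §4 Decomposition: the best two-piece cut, and why it has no leverage -/

/-- Piece A (lattice side, X₀-conditional): from X₀, for `N_f ∈ {2,3}`, ONE chirally pinned regularisation
with mass scaling that carries X₀-type continuum data AND a lattice gap at every positive tuple.
[folklore] -/
def PinnedDataWithLatticeGap : Prop :=
  ContinuumQCDExists → ∀ Nf : ℕ, Nf = 2 ∨ Nf = 3 →
    ∃ reg : QCDRegularisation Nf, reg.HasMassScaling ∧ reg.IsChiralAtZero ∧
      ∀ m : Fin Nf → ℝ, (∀ f, 0 < m f) →
        (∃ (z shift : QCDField Nf → ℕ → ℝ) (T : OSData (QCDField Nf) 4),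
            IsQCDAlong (reg.scheme m z shift) T ∧ T.IsNontrivial QCDField.glue ∧
              T.IsNonGaussian QCDField.glue ∧
                ∀ f g : Fin Nf, f ≠ g → T.IsNontrivial (QCDField.pseudoRe f g)) ∧
          ∃ Δ > 0, (reg.scheme m 0 0).HasLatticeMassGap Δ

/-- Piece B (transfer, `8923`/`stub_gapTransfer`-class): a lattice gap of a scheme carrying QCD data is
inherited, with the same rate, by the continuum OS data. [folklore] -/
def GapTransfer : Prop :=
  ∀ (Nf : ℕ) (sch : QCDScheme Nf) (T : OSData (QCDField Nf) 4) (Δ : ℝ), 0 < Δ →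
    IsQCDAlong sch T → sch.HasLatticeMassGap Δ → T.HasMassGap Δ

/-- **Assembly of the two-piece cut** (proved): `A → B → crux`. [folklore] -/
theorem crux_of_pieces (hA : PinnedDataWithLatticeGap) (hB : GapTransfer) : RobustYangMillsHandover := by
  intro hX
  have key : ∀ Nf : ℕ, Nf = 2 ∨ Nf = 3 → QCDOf Nf := by
    intro Nf hNf
    obtain ⟨reg, hMS, hχ, hall⟩ := hA hX Nf hNf
    refine ⟨reg, hMS, hχ, fun m hm => ?_⟩
    obtain ⟨⟨z, shift, T, hQ, hN, hG, hP⟩, Δ, hΔ, hL⟩ := hall m hm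
    have hL' : (reg.scheme m z shift).HasLatticeMassGap Δ :=
      (hasLatticeMassGap_scheme_indep reg m 0 0 z shift Δ).mp hL
    exact ⟨z, shift, T, hQ, hN, hG, hP, Δ, hΔ, hB Nf _ T Δ hΔ hQ hL', hL'⟩
  exact ⟨key 2 (Or.inl rfl), key 3 (Or.inr rfl)⟩

/-- **Piece A is implied by the crux** (given X₀ the crux yields `QCDOf N_f`, whose regularisation is
pinned, carries the data and both gaps). [folklore] -/
theorem pinnedData_of_crux (hC : RobustYangMillsHandover) : PinnedDataWithLatticeGap := by
  intro hX Nf hNf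
  have hQ : QCDOf Nf := by
    rcases hNf with rfl | rfl
    exacts [(hC hX).1, (hC hX).2]
  obtain ⟨reg, hMS, hχ, hall⟩ := hQ
  refine ⟨reg, hMS, hχ, fun m hm => ?_⟩
  obtain ⟨z, shift, T, hA, hN, hG, hP, Δ, hΔ, -, hL⟩ := hall m hm
  exact ⟨⟨z, shift, T, hA, hN, hG, hP⟩, Δ, hΔ, (hasLatticeMassGap_scheme_indep reg m z shift 0 0 Δ).mp hL⟩

/-- **Certificate of no leverage for the two-piece cut**: modulo the transfer piece, the lattice piece is
EQUIVALENT to the crux — the cut isolates only the (nearly landed) transfer and leaves the whole difficulty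
in piece A. [folklore] -/
theorem pinnedData_iff_crux_of_transfer (hB : GapTransfer) :
    PinnedDataWithLatticeGap ↔ RobustYangMillsHandover :=
  ⟨fun hA => crux_of_pieces hA hB, pinnedData_of_crux⟩

/-! ## §5 Strengthen: the same-regularisation pinned lattice gap serves only the recut -/

/-- `S⁺`: for EVERY chirally pinned, mass-scaling regularisation that carries X₀-type data at all positive
tuples, a lattice gap at every positive tuple (a `∀ reg` rigidification of piece A's lattice clause).
[folklore] -/
def SameRegPinnedLatticeGap : Prop :=
  ∀ Nf : ℕ, Nf = 2 ∨ Nf = 3 → ∀ reg : QCDRegularisation Nf, reg.HasMassScaling → reg.IsChiralAtZero →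
    (∀ m : Fin Nf → ℝ, (∀ f, 0 < m f) →
      ∃ (z shift : QCDField Nf → ℕ → ℝ) (T : OSData (QCDField Nf) 4),
        IsQCDAlong (reg.scheme m z shift) T ∧ T.IsNontrivial QCDField.glue ∧
          T.IsNonGaussian QCDField.glue ∧ ∀ f g : Fin Nf, f ≠ g → T.IsNontrivial (QCDField.pseudoRe f g)) →
    ∀ m : Fin Nf → ℝ, (∀ f, 0 < m f) → ∃ Δ > 0, (reg.scheme m 0 0).HasLatticeMassGap Δ

/-- `S⁺` and the transfer give the RECUT handover … [folklore] -/
theorem chiralHandover_of_sameReg (hS : SameRegPinnedLatticeGap) (hB : GapTransfer) : ChiralHandover := by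
  intro hXχ
  have key : ∀ Nf : ℕ, Nf = 2 ∨ Nf = 3 → QCDOf Nf := by
    intro Nf hNf
    obtain ⟨reg, hMS, hχ, hall⟩ := hXχ Nf hNf
    refine ⟨reg, hMS, hχ, fun m hm => ?_⟩
    obtain ⟨z, shift, T, hQ, hN, hG, hP⟩ := hall m hm
    obtain ⟨Δ, hΔ, hL⟩ := hS Nf hNf reg hMS hχ hall m hm
    have hL' : (reg.scheme m z shift).HasLatticeMassGap Δ :=
      (hasLatticeMassGap_scheme_indep reg m 0 0 z shift Δ).mp hL
    exact ⟨z, shift, T, hQ, hN, hG, hP, Δ, hΔ, hB Nf _ T Δ hΔ hQ hL', hL'⟩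
  exact ⟨key 2 (Or.inl rfl), key 3 (Or.inr rfl)⟩

/-- … and the crux only together with a PINNING SUPPLIER `X₀ → X₀^χ` (the chirality-at-the-pin input no
registered line has: `GaplessPointOnMassAxis`/`noUniformFloor`-class). [folklore] -/
theorem crux_of_sameReg_of_pinning (hS : SameRegPinnedLatticeGap) (hB : GapTransfer)
    (hPin : ContinuumQCDExists → ContinuumQCDExistsChiral) : RobustYangMillsHandover :=
  fun hX => chiralHandover_of_sameReg hS hB (hPin hX)

end Summit.QuantumFields.QCD.Cruxes.RobustYangMillsHandover.CensusS12
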